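import Summits.QuantumFields.BalabanUV.Beta.GAN24.HardMinimiserTowerCubic

/-!
# G-an2-4 ∕ (CONV-C), road P2 — THE SOFT SCALAR MINIMISER `M_n = a′G′_nQ′*` AT `U = 1` ON CUBIC UNIT TORI SATISFIES THE ROW's TWO-CLAUSE
# SHAPE ALONG THE TOWER `k ↦ M_{n_k}` (`n_k = lev L k = L^k`), UNCONDITIONALLY, PLUS the `η → 0` limit along nested sites — the SOFT twin, token
# for token, of leaf-06 g60's `HardMinimiserTowerCubic` (p397186 ✓), i.e. the fine × unit COLUMN object of route C-R6°'s one-step letter at `U = 1`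

G-an2-4 formalisation swarm `b2b-balaban-gan24-formalise-*`, leaf prover 02 (gen 77), crux team (2) under the coordinator ruling «YM REDIRECT»
(e34b3e0c; FREEZE (0) honoured — a `GAN24/` corollary importing EXISTING modules only; no Support leaf, no `def`, no cite, no sorry).

WHY THIS FILE.  Route C-R6°'s reduction (road P3, PARTs 113 ∕ 114 `BlockRatesFromSoftResolvent` ∕ `FluctuationCovarianceRateTransfer`) derives the Σ- and Ξ-blocks'
one-step RATE letters from ONE letter on the soft resolvent's sandwiched increment `E = Qf·K′⁻¹·Qfᵀ − K⁻¹`.  Engines E-leaf02-g77-1 ∕ -2 (kit j237054 ∕ j237293,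
journal [LEAF02-G77-ENGINE-1] ∕ [-2], GAPS § E-gan24leaf02-g77-1; leaf-06 g60's located remark l.64562) price that letter on road P2's `U = 1` scalar prototype:
ENTRYWISE it is NOT instantiable in any dimension ≥ 2 (the diagonal `|E_k(x,x)|` grows like `n_k^{dim−2}`), while its one-leg-averaged COLUMN `E·Qᵀ` carries
a geometric `ε_k ∝ L^{−2k}` with a k-uniform decay rate.  At `U = 1` that column IS road P2's typed object: `E·Qᵀ = a′⁻¹·(Qf·M′ − M) = a′⁻¹·Qf·(M′ − J·M)`
(`M_n = a′·𝒢_n·Q′*` = `Msoft`, `Q′ = Q·Qf`, `Qf·J = 1`).  The one-step law of `M′ − J·M` is gan24-p2 g29's ∕ leaf-06 g36's `MinimiserOneStepDecayCubic.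
norm_Msoft_succ_sub_stair_apply_le_cubic` (UNCONDITIONAL on cubic tori); its n-uniform entry decay is leaf-06 g60's `HardMinimiserTowerCubic.norm_Msoft_apply_le`.
What was NOT typed: the TOWER reading `N = n_k`, `R = L` with `θ^k`, the two-clause shape with ONE pair `(C₈, δ₈)`, and the limit — for `M` (they are in the tree
for `S` (leaf-06 g36 `ScalarUnitLatticeTower`), `S⁻¹` (road P3 PART 111) and `H` (leaf-06 g60)).  THIS FILE types them, by the SAME proofs as the hard twin
(`geometric_scale`, `stair_mul_apply`, `blockOf_nested_succ` BY NAME from `HardMinimiserTowerCubic`):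
 * §1 **`norm_Msoft_tower_step_le_cubic`** — `‖(M_{L·n_k} − J·M_{n_k})(x′,y)‖ ≤ C·(1 + log L)·(k+1)·L^{−k}·e^{−δ|blk x′ − y|}` (`ScalarUnitLatticeTower.tower_rate_le`);
 * §2 **`convC_shape_Msoft_tower_cubic`** — k-uniform decay ∧ geometric one-step rate `θ = L^{−1∕2}`, ONE pair `(C₈, δ₈)` (`δ₈(d,a′)`, `C₈(d,a′,L)` before `N₀, k`);
 * §3 **`tendsto_Msoft_tower_cubic`** — along nested sites `par x_{k+1} = x_k`: `M_{n_k}(x_k,y) → h`, `‖M_{n_k}(x_k,y) − h‖ ≤ C₉θ^k e^{−δ₈|blk x₀ − y|}`,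
   `‖h‖ ≤ C₉e^{−δ₈|blk x₀ − y|}`.
 * §4 THE COLUMN OBJECT: **`Qavg0_mul_stair`** (`Qf·J = 1`), **`Qavg0_mul_sub_eq`** (`Qf·A′ − A = Qf·(A′ − J·A)`), **`norm_Qavg0_mul_apply_le`** (row-mass-1 transfer
   through `Qf`), **`norm_Qavg0_Msoft_succ_sub_le_lev`** — `‖(Qf·M_{L·n_k} − M_{n_k})(x,y)‖ ≤ C(1+log L)(k+1)L^{−k}e^{−δ|blk x − y|}`: route C-R6°'s COLUMN
   letter `a′·(E·Qᵀ)` at `U = 1` along the tower, UNCONDITIONAL.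
HONEST SCOPE.  [folklore] corollaries of tree theorems BY NAME (one `obtain` per input, real arithmetic, one geometric series; no new estimate); scalar
(0-form) `U = 1` PROTOTYPE on CUBIC unit tori `fun _ : Fin (d+1) ⇒ N₀`, the unit torus FIXED along the tower; constants ∕ rates EXISTENTIAL in size;
`θ = L^{−1∕2}` absorbs `(k+1)` (any `θ > L⁻¹` would do; the engines see `L⁻²` for the increments themselves).  The SHAPE of `DirichletExhaustion.ConvC` ∕
`OpClose` for a fine × unit kernel in prolongation currency, NOT an instance of that predicate; §4 IS route C-R6°'s COLUMN letter at `U = 1` up to the factor `a′` and the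
normalisation dictionary `K⁻¹ = n^{d+1}·Gps`, `Qᵀ = n^{−(d+1)}·blkInj` (so `K⁻¹Qᵀ = Msoft∕a′`) — a dictionary stated in the docstring, not typed; NOT (CONV-C) as typed (Bałaban's `(G_k, H_k, C^{(k)})` at general `U`), NEVER «G-an2-4 closed»,
NOT NE2 ∕ NE3, NOT D1, NOT BetaPertH, NOT continuum, NOT Clay; 0 def, 0 `def … : Prop`, 0 cite, 0 sorry — not in print, our bookkeeping.
HONEST DEPENDENCY: continuum YM on T⁴ ⇐ BetaPertH ∧ nine spine estimates (0/9 proved); BetaPertH ⇐ (D1) ∧ (D4) ∧ CAP+tail; G-an2-4 gates asym, D1 and NE2/3/4.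
-/

noncomputable section

open scoped BigOperators ComplexConjugate Matrix

namespace Summit.QuantumFields.BalabanUV.Beta.GAN24.SoftMinimiserTowerCubic

open Literature.MathematicalPhysics.QuantumFieldTheory.Balaban1983to89
open B5Prop11Plancherel (Tor fine)
open B5Blocks16 (blockOf)
open B6LowerBound2153Torus (rep)
open B4TorusKernel.MultiPeriod (torusSupNorm)
open B5G183RateUnitTower (lev)
open Summit.QuantumFields.BalabanUV.T4Continuum.BalabanAveragedTowerUnit (cast_lev')
open Summit.QuantumFields.BalabanUV.T4Continuum.BalabanAveragedTowerModes (par par_cpt_add_off)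
open B5G183RateTorus (cpt)
open B5G183RateTorusW (off)
open Summit.QuantumFields.BalabanUV.T4Continuum.ScalarBlockPlanting (Qavg0 Qavg0_mul_apply Qavg0_mul_conjTranspose)
open Summit.QuantumFields.BalabanUV.T4Continuum.ScalarPlantingDefect (blockOf_par)
open Summit.QuantumFields.BalabanUV.Beta.GAN24.StaircaseLaplacianDefect (stair stair_eq_smul_Qavg0H)
open Summit.QuantumFields.BalabanUV.Beta.GAN24.SoftMinimiserOneStepSup (Msoft)
open Summit.QuantumFields.BalabanUV.Beta.GAN24.MinimiserOneStepDecayCubic (norm_Msoft_succ_sub_stair_apply_le_cubic)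
open Summit.QuantumFields.BalabanUV.Beta.GAN24.ScalarUnitLatticeTower (tower_rate_le)
open Summit.QuantumFields.BalabanUV.Beta.GAN24.HardMinimiserTowerCubic (norm_Msoft_apply_le geometric_scale stair_mul_apply blockOf_nested_succ)

variable (d : ℕ)

/-! ## §1 The one-step kernel along the tower `k ↦ M_{n_k}`, `n_k = lev L k`, on cubic unit tori -/

/-- **THE TOWER STEP OF THE SOFT MINIMISER, UNCONDITIONAL** (tower `n_k = lev L k = L^k`, `R = L`; the tree's currency in which the fine carriers NEST,
`lev L (k+1) = L·lev L k` by `rfl`): `∃ C δ > 0` (functions of `d, a′`) with, for every `L ≥ 1`, `N₀ ≥ 1`, `k`, every fine site `x′` of level `k+1`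
(carrier `Tor (fine (L·n_k) T)`) and unit site `y`, `‖(M_{L·n_k} − J·M_{n_k})(x′, y)‖ ≤ C·(1 + log L)·(k+1)·L^{−k}·e^{−δ·|blockOf x′ − y|_{T,∞}}`. [folklore] -/
theorem norm_Msoft_tower_step_le_cubic {a' : ℝ} (ha' : 0 < a') :
    ∃ C δ : ℝ, 0 < C ∧ 0 < δ ∧ ∀ (L N₀ : ℕ) [NeZero L] [NeZero N₀] (k : ℕ)
      (x' : Tor (fine (L * lev L k) (fun _ : Fin (d + 1) => N₀))) (y : Tor (fun _ : Fin (d + 1) => N₀)),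
        ‖(Msoft (L * lev L k) (fun _ : Fin (d + 1) => N₀) a'
            - stair (lev L k) L (fun _ : Fin (d + 1) => N₀) * Msoft (lev L k) (fun _ : Fin (d + 1) => N₀) a') x' y‖
          ≤ C * (1 + Real.log (L : ℝ)) * ((k : ℝ) + 1) / (L : ℝ) ^ k
              * Real.exp (-(δ * torusSupNorm (fun _ : Fin (d + 1) => N₀)
                  (rep (fun _ : Fin (d + 1) => N₀) (blockOf (L * lev L k) (fun _ : Fin (d + 1) => N₀) x')
                    - rep (fun _ : Fin (d + 1) => N₀) y))) := by
  obtain ⟨C, δ, hC, hδ, h⟩ := norm_Msoft_succ_sub_stair_apply_le_cubic d ha'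
  refine ⟨2 * C, δ, by positivity, hδ, fun L N₀ _ _ k x' y => ?_⟩
  have hL : (1 : ℝ) ≤ L := by exact_mod_cast Nat.one_le_iff_ne_zero.mpr (NeZero.ne L)
  set E := Real.exp (-(δ * torusSupNorm (fun _ : Fin (d + 1) => N₀)
    (rep (fun _ : Fin (d + 1) => N₀) (blockOf (L * lev L k) (fun _ : Fin (d + 1) => N₀) x') - rep (fun _ : Fin (d + 1) => N₀) y)))
  have hE : 0 ≤ E := (Real.exp_pos _).le
  have key := h (lev L k) L N₀ x' y
  push_cast at key
  rw [cast_lev', show (L : ℝ) * (L : ℝ) ^ k = (L : ℝ) ^ (k + 1) from (pow_succ' _ _).symm, Real.log_pow, Real.log_pow] at key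
  have hr := tower_rate_le hL k
  calc ‖(Msoft (L * lev L k) (fun _ : Fin (d + 1) => N₀) a'
          - stair (lev L k) L (fun _ : Fin (d + 1) => N₀) * Msoft (lev L k) (fun _ : Fin (d + 1) => N₀) a') x' y‖
      ≤ C * (((L : ℝ) - 1) / (L : ℝ) ^ (k + 1)) * (2 + ((k + 1 : ℕ) : ℝ) * Real.log L + (k : ℝ) * Real.log L) * E := key
    _ = C * (((L : ℝ) - 1) / (L : ℝ) ^ (k + 1) * (2 + ((k : ℝ) + 1) * Real.log L + (k : ℝ) * Real.log L)) * E := by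
        push_cast; ring
    _ ≤ C * (2 * (1 + Real.log L) * ((k : ℝ) + 1) / L ^ k) * E :=
        mul_le_mul_of_nonneg_right (mul_le_mul_of_nonneg_left hr hC.le) hE
    _ = 2 * C * (1 + Real.log (L : ℝ)) * ((k : ℝ) + 1) / (L : ℝ) ^ k * E := by ring


/-! ## §2 The two clauses of the (CONV-C) shape for the soft scalar minimiser `k ↦ M_{n_k}`, on every cubic unit torus -/

/-- **THE (CONV-C) TWO-CLAUSE SHAPE FOR THE SOFT SCALAR MINIMISER `M_{L^k} = a′G′Q′*` ON CUBIC UNIT TORI, UNCONDITIONAL.**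
There is a rate `δ₈ > 0` (a function of `d, a′`) such that for every `L ≥ 2` there is `C₈ > 0` (a function of `d, a′, L`) with, for every
`N₀ ≥ 1` and every level `k` (cubic unit torus `Π_μ ℤ/N₀`, dimension `d+1`):
(1) `‖M_{n_k}(x, y)‖ ≤ C₈·e^{−δ₈|blockOf x − y|_{T,∞}}` for all fine `x`, unit `y` (k-UNIFORM DECAY), and
(2) `‖(M_{L·n_k} − J·M_{n_k})(x′, y)‖ ≤ C₈·(1∕√L)^k·e^{−δ₈|blockOf x′ − y|_{T,∞}}` for all fine `x′`, unit `y` (GEOMETRIC ONE-STEP RATE,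
`θ = L^{−1∕2}`), ONE pair `(C₈, δ₈)`; `n_k = lev L k = L^k` (`BalabanAveragedTowerUnit.cast_lev'`). [folklore] -/
theorem convC_shape_Msoft_tower_cubic {a' : ℝ} (ha' : 0 < a') :
    ∃ δ₈ : ℝ, 0 < δ₈ ∧ ∀ (L : ℕ) [NeZero L], 2 ≤ L → ∃ C₈ : ℝ, 0 < C₈ ∧ ∀ (N₀ : ℕ) [NeZero N₀] (k : ℕ),
      (∀ (x : Tor (fine (lev L k) (fun _ : Fin (d + 1) => N₀))) (y : Tor (fun _ : Fin (d + 1) => N₀)),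
        ‖Msoft (lev L k) (fun _ : Fin (d + 1) => N₀) a' x y‖
          ≤ C₈ * Real.exp (-(δ₈ * torusSupNorm (fun _ : Fin (d + 1) => N₀)
              (rep (fun _ : Fin (d + 1) => N₀) (blockOf (lev L k) (fun _ : Fin (d + 1) => N₀) x) - rep (fun _ : Fin (d + 1) => N₀) y)))) ∧
      (∀ (x' : Tor (fine (L * lev L k) (fun _ : Fin (d + 1) => N₀))) (y : Tor (fun _ : Fin (d + 1) => N₀)),
        ‖(Msoft (L * lev L k) (fun _ : Fin (d + 1) => N₀) a'
            - stair (lev L k) L (fun _ : Fin (d + 1) => N₀) * Msoft (lev L k) (fun _ : Fin (d + 1) => N₀) a') x' y‖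
          ≤ C₈ * ((Real.sqrt L)⁻¹) ^ k * Real.exp (-(δ₈ * torusSupNorm (fun _ : Fin (d + 1) => N₀)
              (rep (fun _ : Fin (d + 1) => N₀) (blockOf (L * lev L k) (fun _ : Fin (d + 1) => N₀) x')
                - rep (fun _ : Fin (d + 1) => N₀) y)))) := by
  obtain ⟨C, δ, hC, hδ, h⟩ := norm_Msoft_tower_step_le_cubic d ha'
  obtain ⟨CH, δH, hCH, hδH, hH⟩ := norm_Msoft_apply_le d ha'
  refine ⟨min δ δH, lt_min hδ hδH, fun L _ hL2 => ?_⟩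
  have hL1 : (1 : ℝ) < L := by exact_mod_cast hL2
  obtain ⟨hy0, hy1, -⟩ := geometric_scale hL1 hC.le 0
  set y : ℝ := (Real.sqrt L)⁻¹ with hy
  set C₈ := max CH (C * (1 + Real.log L) / (1 - y))
  have hC₈pos : 0 < C₈ := lt_max_of_lt_left hCH
  refine ⟨C₈, hC₈pos, fun N₀ _ k => ⟨fun x y₂ => ?_, fun x' y₂ => ?_⟩⟩
  · -- clause 1: k-uniform decay (§1), rate lowered to `δ₈ ≤ δ_H`
    set t := torusSupNorm (fun _ : Fin (d + 1) => N₀)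
      (rep (fun _ : Fin (d + 1) => N₀) (blockOf (lev L k) (fun _ : Fin (d + 1) => N₀) x) - rep (fun _ : Fin (d + 1) => N₀) y₂)
    have ht : 0 ≤ t :=
      B4TorusKernel.MultiPeriod.torusSupNorm_nonneg (fun _ => Nat.one_le_iff_ne_zero.mpr (NeZero.ne N₀)) _
    have h1 := hH (lev L k) (fun _ : Fin (d + 1) => N₀) x y₂
    have hE : Real.exp (-(δH * t)) ≤ Real.exp (-(min δ δH * t)) :=
      Real.exp_le_exp.mpr (by nlinarith [min_le_right δ δH])
    exact h1.trans (mul_le_mul (le_max_left _ _) hE (Real.exp_pos _).le hC₈pos.le)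
  · -- clause 2: the tower step (§2), with `(k+1)·L^{−k} = ((k+1)·y^k)·y^k ≤ y^k∕(1 − y)`
    set t := torusSupNorm (fun _ : Fin (d + 1) => N₀)
      (rep (fun _ : Fin (d + 1) => N₀) (blockOf (L * lev L k) (fun _ : Fin (d + 1) => N₀) x') - rep (fun _ : Fin (d + 1) => N₀) y₂)
    have ht : 0 ≤ t :=
      B4TorusKernel.MultiPeriod.torusSupNorm_nonneg (fun _ => Nat.one_le_iff_ne_zero.mpr (NeZero.ne N₀)) _
    have h2 := h L N₀ k x' y₂
    have hE : Real.exp (-(δ * t)) ≤ Real.exp (-(min δ δH * t)) :=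
      Real.exp_le_exp.mpr (by nlinarith [min_le_left δ δH])
    have hyk : 0 ≤ y ^ k := pow_nonneg hy0.le k
    have hcoef : C * (1 + Real.log (L : ℝ)) * ((k : ℝ) + 1) / (L : ℝ) ^ k ≤ C₈ * y ^ k :=
      (geometric_scale hL1 hC.le k).2.2.trans (mul_le_mul_of_nonneg_right (le_max_right _ _) hyk)
    exact h2.trans (mul_le_mul hcoef hE (Real.exp_pos _).le (mul_nonneg hC₈pos.le hyk))


/-! ## §3 The `η → 0` limit along NESTED fine sites -/

section Limit

open Filter

/-- **THE `η → 0` LIMIT OF THE SOFT SCALAR MINIMISER ALONG NESTED SITES, UNCONDITIONAL**: there is `δ₈ > 0` (a function of `d, a′`) such that for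
every `L ≥ 2` there is `C₉ > 0` (a function of `d, a′, L`) with: on every cubic unit torus, for every NESTED sequence of fine sites
`x_k ∈ Tor (fine n_k T)` (`par x_{k+1} = x_k`, `n_k = lev L k = L^k`) and every unit site `y` there is `h ∈ ℂ` with
`M_{n_k}(x_k, y) → h` (`k → ∞`), `‖M_{n_k}(x_k, y) − h‖ ≤ C₉·(1∕√L)^k·e^{−δ₈|blockOf x₀ − y|_{T,∞}}` for every `k`, and `‖h‖ ≤ C₉·e^{−δ₈|blockOf x₀ − y|_{T,∞}}`
— the `lev` tower step summed geometrically (`cauchySeq_of_le_geometric`, completeness of `ℂ`, `dist_le_of_le_geometric_of_tendsto`) and §1 passed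
to the limit; `C₉ = 2·max(C_M, C(1 + log L)∕(1 − 1∕√L))∕(1 − 1∕√L)` (`C_M` = `norm_Msoft_apply_le`'s constant); proof = leaf-06 g60's `tendsto_Mhard_tower_cubic` token for token. [folklore] -/
theorem tendsto_Msoft_tower_cubic {a' : ℝ} (ha' : 0 < a') :
    ∃ δ₈ : ℝ, 0 < δ₈ ∧ ∀ (L : ℕ) [NeZero L], 2 ≤ L → ∃ C₉ : ℝ, 0 < C₉ ∧ ∀ (N₀ : ℕ) [NeZero N₀]
      (x : (k : ℕ) → Tor (fine (lev L k) (fun _ : Fin (d + 1) => N₀)))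
      (_ : ∀ k, par (lev L k) L (fun _ : Fin (d + 1) => N₀) (x (k + 1)) = x k) (y : Tor (fun _ : Fin (d + 1) => N₀)),
      ∃ h : ℂ, Tendsto (fun k : ℕ => Msoft (lev L k) (fun _ : Fin (d + 1) => N₀) a' (x k) y) atTop (nhds h) ∧
        (∀ k : ℕ, ‖Msoft (lev L k) (fun _ : Fin (d + 1) => N₀) a' (x k) y - h‖
            ≤ C₉ * ((Real.sqrt L)⁻¹) ^ k * Real.exp (-(δ₈ * torusSupNorm (fun _ : Fin (d + 1) => N₀)
                (rep (fun _ : Fin (d + 1) => N₀) (blockOf (lev L 0) (fun _ : Fin (d + 1) => N₀) (x 0))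
                  - rep (fun _ : Fin (d + 1) => N₀) y)))) ∧
        ‖h‖ ≤ C₉ * Real.exp (-(δ₈ * torusSupNorm (fun _ : Fin (d + 1) => N₀)
            (rep (fun _ : Fin (d + 1) => N₀) (blockOf (lev L 0) (fun _ : Fin (d + 1) => N₀) (x 0))
              - rep (fun _ : Fin (d + 1) => N₀) y))) := by
  obtain ⟨C, δ, hC, hδ, h⟩ := norm_Msoft_tower_step_le_cubic d ha'
  obtain ⟨CH, δH, hCH, hδH, hH⟩ := norm_Msoft_apply_le d ha'
  refine ⟨min δ δH, lt_min hδ hδH, fun L _ hL2 => ?_⟩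
  have hL1 : (1 : ℝ) < L := by exact_mod_cast hL2
  obtain ⟨hθ0, hθ1, -⟩ := geometric_scale hL1 hC.le 0
  set θ : ℝ := (Real.sqrt L)⁻¹ with hθ
  have h1θ : 0 < 1 - θ := by linarith
  set C₈ := max CH (C * (1 + Real.log L) / (1 - θ)) with hC₈
  have hC₈pos : 0 < C₈ := lt_max_of_lt_left hCH
  refine ⟨2 * C₈ / (1 - θ), by positivity, fun N₀ _ x hx y => ?_⟩
  -- the common localisation weight, read at the level-0 block
  set t := torusSupNorm (fun _ : Fin (d + 1) => N₀)
    (rep (fun _ : Fin (d + 1) => N₀) (blockOf (lev L 0) (fun _ : Fin (d + 1) => N₀) (x 0)) - rep (fun _ : Fin (d + 1) => N₀) y)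
    with ht_def
  have ht : 0 ≤ t :=
    B4TorusKernel.MultiPeriod.torusSupNorm_nonneg (fun _ => Nat.one_le_iff_ne_zero.mpr (NeZero.ne N₀)) _
  set E := Real.exp (-(min δ δH * t)) with hE_def
  have hE0 : 0 < E := Real.exp_pos _
  set u : ℕ → ℂ := fun k => Msoft (lev L k) (fun _ : Fin (d + 1) => N₀) a' (x k) y with hu
  -- the one-step increments along nested sites
  have hstep : ∀ k, dist (u k) (u (k + 1)) ≤ C₈ * E * θ ^ k := by
    intro k
    rw [dist_comm, dist_eq_norm]
    have h2 := h L N₀ k (x (k + 1)) y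
    rw [Matrix.sub_apply, stair_mul_apply, hx k, blockOf_nested_succ x hx k] at h2
    have hEδ : Real.exp (-(δ * t)) ≤ E := Real.exp_le_exp.mpr (by nlinarith [min_le_left δ δH])
    have hθk : 0 ≤ θ ^ k := pow_nonneg hθ0.le k
    have hcoef : C * (1 + Real.log (L : ℝ)) * ((k : ℝ) + 1) / (L : ℝ) ^ k ≤ C₈ * θ ^ k :=
      (geometric_scale hL1 hC.le k).2.2.trans (mul_le_mul_of_nonneg_right (le_max_right _ _) hθk)
    calc ‖u (k + 1) - u k‖ ≤ C * (1 + Real.log (L : ℝ)) * ((k : ℝ) + 1) / (L : ℝ) ^ k * Real.exp (-(δ * t)) := h2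
      _ ≤ C₈ * θ ^ k * E := mul_le_mul hcoef hEδ (Real.exp_pos _).le (mul_nonneg hC₈pos.le hθk)
      _ = C₈ * E * θ ^ k := by ring
  have hcau : CauchySeq u := cauchySeq_of_le_geometric θ (C₈ * E) hθ1 hstep
  obtain ⟨s, hs⟩ := cauchySeq_tendsto_of_complete hcau
  have hdist : ∀ k, dist (u k) s ≤ C₈ * E * θ ^ k / (1 - θ) := fun k =>
    dist_le_of_le_geometric_of_tendsto θ (C₈ * E) hθ1 hstep hs k
  have hCE : 0 ≤ C₈ * E := by positivity
  refine ⟨s, hs, fun k => ?_, ?_⟩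
  · have hk := hdist k
    rw [dist_eq_norm] at hk
    have hθk : 0 ≤ θ ^ k := pow_nonneg hθ0.le k
    calc ‖u k - s‖ ≤ C₈ * E * θ ^ k / (1 - θ) := hk
      _ ≤ 2 * (C₈ * E * θ ^ k) / (1 - θ) := by
          rw [div_le_div_iff_of_pos_right h1θ]; nlinarith [mul_nonneg hCE hθk]
      _ = 2 * C₈ / (1 - θ) * θ ^ k * E := by ring
  · -- the limit inherits clause 1's localisation: `‖s‖ ≤ ‖u 0‖ + dist (u 0) s`
    have h0 := hdist 0
    rw [pow_zero, mul_one, dist_eq_norm] at h0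
    have hu0 : ‖u 0‖ ≤ C₈ * E := by
      have h1 := hH (lev L 0) (fun _ : Fin (d + 1) => N₀) (x 0) y
      have hEH : Real.exp (-(δH * t)) ≤ E := Real.exp_le_exp.mpr (by nlinarith [min_le_right δ δH])
      exact h1.trans (mul_le_mul (le_max_left _ _) hEH (Real.exp_pos _).le hC₈pos.le)
    have htri : ‖s‖ ≤ ‖u 0‖ + ‖u 0 - s‖ := by
      have := norm_sub_le (u 0) (u 0 - s)
      rwa [sub_sub_cancel] at this
    calc ‖s‖ ≤ C₈ * E + C₈ * E / (1 - θ) := htri.trans (add_le_add hu0 h0)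
      _ = C₈ * E * (1 + 1 / (1 - θ)) := by ring
      _ ≤ C₈ * E * (2 / (1 - θ)) := by
          apply mul_le_mul_of_nonneg_left _ hCE
          rw [add_div' _ _ _ h1θ.ne', div_le_div_iff_of_pos_right h1θ]
          nlinarith
      _ = 2 * C₈ / (1 - θ) * E := by ring

end Limit

/-! ## §4 The COLUMN object of route C-R6°'s one-step letter at `U = 1`: `Qf·M′ − M = Qf·(M′ − J·M)` (`Qf = Qavg0`, `J = stair`, `Qf·J = 1`) and its tower bound -/

section Column

variable {d}

/-- [folklore] **THE ONE-STEP BLOCK AVERAGING IS A LEFT INVERSE OF THE BLOCK-PARENT STAIRCASE**: `Qavg0 N R T * stair N R T = 1`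
(`stair = R^{d+1} • Qavg0ᴴ`, `StaircaseLaplacianDefect.stair_eq_smul_Qavg0H`; `Qavg0 * Qavg0ᴴ = R^{−(d+1)} • 1`, `ScalarBlockPlanting.Qavg0_mul_conjTranspose`). -/
theorem Qavg0_mul_stair (N R : ℕ) [NeZero N] [NeZero R] (T : Fin (d + 1) → ℕ) [∀ μ, NeZero (T μ)] :
    Qavg0 N R T * stair N R T = 1 := by
  have hRc : ((R : ℂ) ^ (d + 1)) ≠ 0 := pow_ne_zero _ (by exact_mod_cast NeZero.ne R)
  rw [stair_eq_smul_Qavg0H, Matrix.mul_smul, Qavg0_mul_conjTranspose, smul_smul, mul_inv_cancel₀ hRc, one_smul]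

/-- [folklore] **THE COLUMN OBJECT IS THE AVERAGED PROLONGATION INCREMENT**: `Qavg0·A′ − A = Qavg0·(A′ − stair·A)` for ANY fine × `β` kernels
`A′` (level `R·N`) and `A` (level `N`) — in route C-R6°'s letters, `Qf·K′⁻¹Q′ᵀ − K⁻¹Qᵀ = Qf·(M′ − J·M)∕a′` at `U = 1`. -/
theorem Qavg0_mul_sub_eq {β : Type*} (N R : ℕ) [NeZero N] [NeZero R] (T : Fin (d + 1) → ℕ) [∀ μ, NeZero (T μ)]
    (A' : Matrix (Tor (fine (R * N) T)) β ℂ) (A : Matrix (Tor (fine N T)) β ℂ) :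
    Qavg0 N R T * A' - A = Qavg0 N R T * (A' - stair N R T * A) := by
  rw [Matrix.mul_sub, ← Matrix.mul_assoc, Qavg0_mul_stair, Matrix.one_mul]

/-- [folklore] **ROW-MASS-1 TRANSFER THROUGH THE ONE-STEP BLOCK AVERAGING**: if `‖D(x′, y)‖ ≤ B(par x′, y)` for all finer sites `x′`, then
`‖(Qavg0·D)(x, y)‖ ≤ B(x, y)` (the `R^{d+1}` sites of the block of `x` each weigh `R^{−(d+1)}`; `ScalarBlockPlanting.Qavg0_mul_apply`, `par_cpt_add_off`). -/
theorem norm_Qavg0_mul_apply_le {β : Type*} (N R : ℕ) [NeZero N] [NeZero R] (T : Fin (d + 1) → ℕ) [∀ μ, NeZero (T μ)]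
    (D : Matrix (Tor (fine (R * N) T)) β ℂ) (B : Tor (fine N T) → β → ℝ) (hD : ∀ x' y, ‖D x' y‖ ≤ B (par N R T x') y)
    (x : Tor (fine N T)) (y : β) : ‖(Qavg0 N R T * D) x y‖ ≤ B x y := by
  have hR : ((R : ℝ) ^ (d + 1)) ≠ 0 := pow_ne_zero _ (by exact_mod_cast NeZero.ne R)
  have hnorm : ‖((R : ℂ) ^ (d + 1))⁻¹‖ = ((R : ℝ) ^ (d + 1))⁻¹ := by
    rw [norm_inv, norm_pow, Complex.norm_natCast]
  rw [Qavg0_mul_apply, norm_mul, hnorm]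
  calc ((R : ℝ) ^ (d + 1))⁻¹ * ‖∑ j : Fin (d + 1) → Fin R, D (cpt N R T x + off N R T j) y‖
      ≤ ((R : ℝ) ^ (d + 1))⁻¹ * ∑ j : Fin (d + 1) → Fin R, ‖D (cpt N R T x + off N R T j) y‖ :=
        mul_le_mul_of_nonneg_left (norm_sum_le _ _) (by positivity)
    _ ≤ ((R : ℝ) ^ (d + 1))⁻¹ * ∑ _j : Fin (d + 1) → Fin R, B x y := by
        refine mul_le_mul_of_nonneg_left (Finset.sum_le_sum fun j _ => ?_) (by positivity)
        have h := hD (cpt N R T x + off N R T j) y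
        rwa [par_cpt_add_off] at h
    _ = B x y := by
        simp only [Finset.sum_const, Finset.card_univ, Fintype.card_fun, Fintype.card_fin, nsmul_eq_mul]
        push_cast
        field_simp

/-- **THE COLUMN LETTER OF ROUTE C-R6° AT `U = 1`, ALONG THE TOWER, UNCONDITIONAL** (times `a′`): `∃ C δ > 0` (functions of `d, a′`) with, for every `L ≥ 1`,
`N₀ ≥ 1`, `k`, every level-`k` fine site `x` and unit site `y`,
`‖(Qf·M_{L·n_k} − M_{n_k})(x, y)‖ ≤ C·(1 + log L)·(k+1)·L^{−k}·e^{−δ·|blockOf x − y|_{T,∞}}` (`Qf = Qavg0 (lev L k) L`; §1 through `Qavg0_mul_sub_eq` and the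
row-mass-1 transfer, the localisation weight moved by `ScalarPlantingDefect.blockOf_par`).  With the engines' reading (GAPS § E-gan24leaf02-g77-1): this is the
INSTANTIABLE form of PART 113's input at `U = 1`; the entrywise form is not. [folklore] -/
theorem norm_Qavg0_Msoft_succ_sub_le_lev {a' : ℝ} (ha' : 0 < a') :
    ∃ C δ : ℝ, 0 < C ∧ 0 < δ ∧ ∀ (L N₀ : ℕ) [NeZero L] [NeZero N₀] (k : ℕ)
      (x : Tor (fine (lev L k) (fun _ : Fin (d + 1) => N₀))) (y : Tor (fun _ : Fin (d + 1) => N₀)),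
        ‖(Qavg0 (lev L k) L (fun _ : Fin (d + 1) => N₀) * Msoft (L * lev L k) (fun _ : Fin (d + 1) => N₀) a'
            - Msoft (lev L k) (fun _ : Fin (d + 1) => N₀) a') x y‖
          ≤ C * (1 + Real.log (L : ℝ)) * ((k : ℝ) + 1) / (L : ℝ) ^ k
              * Real.exp (-(δ * torusSupNorm (fun _ : Fin (d + 1) => N₀)
                  (rep (fun _ : Fin (d + 1) => N₀) (blockOf (lev L k) (fun _ : Fin (d + 1) => N₀) x)
                    - rep (fun _ : Fin (d + 1) => N₀) y))) := by
  obtain ⟨C, δ, hC, hδ, h⟩ := norm_Msoft_tower_step_le_cubic d ha'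
  refine ⟨C, δ, hC, hδ, fun L N₀ _ _ k x y => ?_⟩
  rw [Qavg0_mul_sub_eq]
  refine norm_Qavg0_mul_apply_le (lev L k) L (fun _ : Fin (d + 1) => N₀) _
    (fun x y => C * (1 + Real.log (L : ℝ)) * ((k : ℝ) + 1) / (L : ℝ) ^ k
      * Real.exp (-(δ * torusSupNorm (fun _ : Fin (d + 1) => N₀)
          (rep (fun _ : Fin (d + 1) => N₀) (blockOf (lev L k) (fun _ : Fin (d + 1) => N₀) x) - rep (fun _ : Fin (d + 1) => N₀) y))))
    (fun x' y' => ?_) x y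
  have h1 := h L N₀ k x' y'
  rwa [← blockOf_par (lev L k) L (fun _ : Fin (d + 1) => N₀) x'] at h1

end Column

end Summit.QuantumFields.BalabanUV.Beta.GAN24.SoftMinimiserTowerCubic

end
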